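import Summits.Ventures.CertifiedQuantumChemistry.Rows.SymmetryBlockWords
import HarnessLib

/-!
# Ventures/CertifiedQuantumChemistry — Rows/SymmetryBlockTables.lean: tabulated block matrices and the symmetries of `bMatP` (typer aside T-06b, part 3 of 3)

HONEST FRAMING (verbatim): certified bounds for a stated model Hamiltonian in a stated basis; not a
claim about the real molecule beyond that model.

Continues `Rows/SymmetryBlockWords.lean`: for matrices of the shape `B = N·T + diagonal` the block matrix splits as
`16 · (N · CT + D · stabSum)` (`blockMat_split`); a TABULATED block matrix `blockTV` equals `blockMat` once its two
small tables are checked (`blockTV_eq`, decidable hypotheses), so the per-instance Gram check runs on table look-ups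
(`block_nonneg_of_table`). Finally the two shapes of symmetry of the two-species sector matrix `bMatP` of
`…CooperPairDMottWalkPlaquetteGramCert`: a signed product of one-species table symmetries and the species swap
(`preserves_bMatP_prod`, `preserves_bMatP_swap`; `hopT`, `bMatP_eq_hopT`). 0 `sorry`. Typer `pub-qchem-typer` (gen 3), 0 core-h.
-/

namespace Summit.Ventures.CertifiedQuantumChemistry

open Matrix Finset
open Summit.HubbardSuperconductivity.HubbardSuperconductivity.Theorems.CooperPairDMottWalk

namespace SymmetryBlocks

open SgnMap

section Four

variable {ι : Type*} [Fintype ι] [DecidableEq ι] {g : Fin 4 → SgnMap ι} {B : ι → ι → ℤ}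

/-! ### Structured block matrices: `B = N·T + diagonal` -/

section Split

variable (b0 b1 b2 b3 : Bool) {d : ℕ} (r : Fin d → ι)

variable (g) in
/-- The `T`-part of the block matrix: `CT k l = Σ_w Pcoef_b w (r l) · T (r k) (Pimg w (r l))` (for the sector
matrices of `Rows/HubbardRingKernel.lean` this is `U`-independent). [folklore] -/
def CT (T : ι → ι → ℤ) (k l : Fin d) : ℤ :=
  wsum fun w0 w1 w2 w3 => Pcoef g b0 b1 b2 b3 w0 w1 w2 w3 (r l) * T (r k) (Pimg g w0 w1 w2 w3 (r l))

variable (g) in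
/-- The diagonal part of the block matrix: `Σ_{w : Pimg w (r l) = r k} Pcoef_b w (r l)` (the signed stabiliser
count; zero between different orbits). [folklore] -/
def stabSum (k l : Fin d) : ℤ :=
  wsum fun w0 w1 w2 w3 => if Pimg g w0 w1 w2 w3 (r l) = r k then Pcoef g b0 b1 b2 b3 w0 w1 w2 w3 (r l) else 0

/-- The block matrix assembled from TABLES: `16 · (N · CTm k l + (Ut · dv k − m) · [k = l] · stab k)`. [folklore] -/
def blockTV (CTm : Fin d → Fin d → ℤ) (stab dv : Fin d → ℤ) (N Ut m : ℤ) (k l : Fin d) : ℤ :=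
  16 * (N * CTm k l + (Ut * dv k - m) * (if k = l then stab k else 0))

variable {b0 b1 b2 b3 r}

/-- One word term of `blockMat` splits into its `T` and diagonal parts. -/
private theorem term_split (c N T' Dv : ℤ) (P : Prop) [Decidable P] :
    c * (N * T' + if P then Dv else 0) = N * (c * T') + Dv * (if P then c else 0) := by
  split_ifs <;> ring

omit [Fintype ι] in
/-- `blockMat` of a matrix of the shape `N·T + diagonal` splits accordingly. -/
theorem blockMat_split {T : ι → ι → ℤ} {D : ι → ℤ} {N : ℤ}
    (hB : ∀ a c, B a c = N * T a c + (if c = a then D a else 0)) (k l : Fin d) :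
    blockMat g B b0 b1 b2 b3 r k l =
      16 * (N * CT g b0 b1 b2 b3 r T k l + D (r k) * stabSum g b0 b1 b2 b3 r k l) := by
  simp only [blockMat, CT, stabSum, wsum, hB, term_split]
  ring

omit [Fintype ι] in
/-- The tabulated block matrix equals `blockMat` once the tables are checked (`hCT`, `hstab` decidable). -/
theorem blockTV_eq {T : ι → ι → ℤ} {dd : ι → ℤ} {N Ut m : ℤ}
    (hB : ∀ a c, B a c = N * T a c + (if c = a then Ut * dd a - m else 0))
    {CTm : Fin d → Fin d → ℤ} {stab dv : Fin d → ℤ} (hCT : ∀ k l, CTm k l = CT g b0 b1 b2 b3 r T k l)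
    (hstab : ∀ k l, (if k = l then stab k else 0) = stabSum g b0 b1 b2 b3 r k l)
    (hdv : ∀ k, dv k = dd (r k)) (k l : Fin d) :
    blockTV CTm stab dv N Ut m k l = blockMat g B b0 b1 b2 b3 r k l := by
  rw [blockMat_split hB, blockTV, hCT, hstab, hdv]

/-- `block_nonneg` with the block matrix supplied as a checked table. -/
theorem block_nonneg_of_table (hg : ∀ i, (g i).isInvol = true) (hc : ∀ i j, (g i).comm (g j) = true)
    (hB : ∀ i, (g i).preserves B = true) {n : ℕ} (reps : Fin n → ι) (ρ : ι → Fin n)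
    (word : ι → Bool × Bool × Bool × Bool)
    (hword : ∀ a, Pimg g (word a).1 (word a).2.1 (word a).2.2.1 (word a).2.2.2 (reps (ρ a)) = a)
    (live : Fin d → Fin n) (back : Fin n → Fin d) (kill : Fin n → Bool × Bool × Bool × Bool)
    (hlive : ∀ k, live (back k) = k ∨
      (Pimg g (kill k).1 (kill k).2.1 (kill k).2.2.1 (kill k).2.2.2 (reps k) = reps k ∧
        Pcoef g b0 b1 b2 b3 (kill k).1 (kill k).2.1 (kill k).2.2.1 (kill k).2.2.2 (reps k) = -1))
    (C : Fin d → Fin d → ℤ) (hCeq : ∀ k l, C k l = blockMat g B b0 b1 b2 b3 (fun k' => reps (live k')) k l)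
    (G : Fin d → Fin d → ℤ) {σ : ℤ} (hσ : 0 < σ) (hchk : ddCheckP C G σ = true) (x : ι → ℝ) :
    0 ≤ zform B (P4 g b0 b1 b2 b3 x) (P4 g b0 b1 b2 b3 x) := by
  have hCf : C = blockMat g B b0 b1 b2 b3 (fun k' => reps (live k')) :=
    funext fun k => funext fun l => hCeq k l
  subst hCf
  exact block_nonneg hg hc b0 b1 b2 b3 hB reps ρ word hword live back kill hlive G hσ hchk x

end Split

end Four

/-! ## Symmetries of the two-species sector matrix `bMatP` -/

section BMat

variable {p q : ℕ}

/-- A signed product map `(i, j) ↦ (σ i, τ j)` with sign `α i · β j`. [folklore] -/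
def prodMap (σ : Fin p → Fin p) (τ : Fin q → Fin q) (α : Fin p → ℤ) (β : Fin q → ℤ) :
    SgnMap (Fin p × Fin q) :=
  ⟨fun a => (σ a.1, τ a.2), fun a => α a.1 * β a.2⟩

/-- The species swap `(i, j) ↦ (j, i)` (no sign). [folklore] -/
def swapMap : SgnMap (Fin p × Fin p) := ⟨fun a => (a.2, a.1), fun _ => 1⟩

/-- A signed product of involutive table symmetries preserves `bMatP`. -/
theorem preserves_bMatP_prod (Ka : Fin p → Fin p → ℤ) (Kb : Fin q → Fin q → ℤ)
    (d : Fin p → Fin q → ℕ) (N Ut m : ℤ) {σ : Fin p → Fin p} {τ : Fin q → Fin q} {α : Fin p → ℤ}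
    {β : Fin q → ℤ} (hσ : ∀ i, σ (σ i) = i) (hτ : ∀ j, τ (τ j) = j) (hα : ∀ i, α i * α i = 1)
    (hβ : ∀ j, β j * β j = 1) (hKa : ∀ i i', Ka (σ i) (σ i') * (α i * α i') = Ka i i')
    (hKb : ∀ j j', Kb (τ j) (τ j') * (β j * β j') = Kb j j') (hd : ∀ i j, d (σ i) (τ j) = d i j) :
    (prodMap σ τ α β).preserves (bMatP Ka Kb d N Ut m) = true := by
  have hσi : ∀ i i', σ i = σ i' ↔ i = i' := fun i i' =>
    ⟨fun h => by simpa [hσ] using congrArg σ h, fun h => h ▸ rfl⟩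
  have hτi : ∀ j j', τ j = τ j' ↔ j = j' := fun j j' =>
    ⟨fun h => by simpa [hτ] using congrArg τ h, fun h => h ▸ rfl⟩
  refine decide_eq_true fun a b => ?_
  obtain ⟨i, j⟩ := a
  obtain ⟨i', j'⟩ := b
  simp only [bMatP, prodMap, Prod.mk.injEq, hσi, hτi]
  have h1 : (if j = j' then Ka (σ i) (σ i') else 0) * (α i * β j * (α i' * β j')) =
      if j = j' then Ka i i' else 0 := by
    by_cases hj : j = j'
    · subst hj; rw [if_pos rfl, if_pos rfl]
      linear_combination (β j * β j) * hKa i i' + Ka i i' * hβ j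
    · rw [if_neg hj, if_neg hj, zero_mul]
  have h2 : (if i = i' then Kb (τ j) (τ j') else 0) * (α i * β j * (α i' * β j')) =
      if i = i' then Kb j j' else 0 := by
    by_cases hi : i = i'
    · subst hi; rw [if_pos rfl, if_pos rfl]
      linear_combination (α i * α i) * hKb j j' + Kb j j' * hα i
    · rw [if_neg hi, if_neg hi, zero_mul]
  have h3 : (if i' = i ∧ j' = j then Ut * (d (σ i) (τ j) : ℤ) - m else 0) *
      (α i * β j * (α i' * β j')) = if i' = i ∧ j' = j then Ut * (d i j : ℤ) - m else 0 := by
    by_cases hij : i' = i ∧ j' = j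
    · obtain ⟨rfl, rfl⟩ := hij
      rw [if_pos ⟨rfl, rfl⟩, if_pos ⟨rfl, rfl⟩, hd]
      linear_combination (Ut * (d i' j' : ℤ) - m) * (β j' * β j') * hα i' +
        (Ut * (d i' j' : ℤ) - m) * hβ j'
    · rw [if_neg hij, if_neg hij, zero_mul]
  linear_combination N * h1 + N * h2 + h3

/-- The species swap preserves `bMatP K K d` when `d` is symmetric. -/
theorem preserves_bMatP_swap (K : Fin p → Fin p → ℤ) (d : Fin p → Fin p → ℕ) (N Ut m : ℤ)
    (hd : ∀ i j, d j i = d i j) : (swapMap (p := p)).preserves (bMatP K K d N Ut m) = true := by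
  refine decide_eq_true fun a b => ?_
  obtain ⟨i, j⟩ := a
  obtain ⟨i', j'⟩ := b
  simp only [bMatP, swapMap, Prod.mk.injEq, mul_one, hd]
  have : (j' = j ∧ i' = i) ↔ (i' = i ∧ j' = j) := and_comm
  simp only [this]
  ring

/-- The hopping part of `bMatP`: `T a c = [a.2 = c.2] Ka a.1 c.1 + [a.1 = c.1] Kb a.2 c.2`. [folklore] -/
def hopT (Ka : Fin p → Fin p → ℤ) (Kb : Fin q → Fin q → ℤ) (a c : Fin p × Fin q) : ℤ :=
  (if a.2 = c.2 then Ka a.1 c.1 else 0) + (if a.1 = c.1 then Kb a.2 c.2 else 0)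

/-- `bMatP = N · hopT + diagonal`. -/
theorem bMatP_eq_hopT (Ka : Fin p → Fin p → ℤ) (Kb : Fin q → Fin q → ℤ) (d : Fin p → Fin q → ℕ)
    (N Ut m : ℤ) (a c : Fin p × Fin q) :
    bMatP Ka Kb d N Ut m a c =
      N * hopT Ka Kb a c + (if c = a then Ut * (fun e : Fin p × Fin q => (d e.1 e.2 : ℤ)) a - m else 0) := by
  simp only [bMatP, hopT]
  ring

end BMat

end SymmetryBlocks

end Summit.Ventures.CertifiedQuantumChemistry
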